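import Summits.NavierStokesRegularity.TurbBounds.TailN0Glue
import Summits.NavierStokesRegularity.TurbBounds.RBDensity
import HarnessLib

/-!
# Row RB-N0 (CERTIFIED.md RB-N0: Ra = 10³, conduction background, s = 3 — `Nu ≤ 1` for every horizontal period): the Legendre TAIL LEMMA
# and the FULL-GAP positivity of the mode form for every `K = k² > 0`, PROVED from the tree's finite certificate
(cell `pub-turb` / `turb-bounds`; v2 — first RB row with a kernel-checked chain; written by pub-turb-cert, prover-pub-turb-cert-g6-0.)

HONEST FRAMING: rigorous bounds for the stated PDE and boundary conditions; no claim about physical turbulence beyond the bound.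
KERNEL-CHECKED here (standard axioms, no `sorry`, no `native_decide`): for every `K > 0`, the RB-type form
`rbForm a0 s (−s) K [W, Θ] = ∫_{-1}^{1} a0(16W″²/K + 8W′² + KW²) + s(4Θ′² + KΘ²) − 2s·W·Θ dx` (`a0 = (s−1)/Ra = 1/500`, `s = 3`) is `≥ 0`
on the two-sided class `W(±1) = W′(±1) = 0`, `Θ(±1) = 0` (`rbPositivity_holds`): on `0 < K ≤ 39` from `Certs.N0.Evaluator.certificate`
(17 LMIs of dimension 18 with the interval lemmas R-I/R-I′, tree) through the tail lemma proved here — generic `(N, P) = (8, 0)` lower bound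
`TailPolyGenW.rbForm_poly_lower_bound`, the bridge `TailN0.finGenW_eq_quadForm` (literal projected rule = tracked finite part on the kept
coordinates, far-wall conditions `c₀ = c₁ = d₀ = 0` from `TailTwoSided.legCoeff_farWall_*`), PSD + the two slack lines, and the two-sided
density `RBDensity.rbForm_nonneg_of_poly2`; on `K ≥ 39` from the tree's cutoff line `Certs.N0.Evaluator.cutoff` via `TailTwoSided.rbPositivity_of_cover`.
By `RBSpectralLink` (file `Results/N0Spectral.lean`) this is exactly the spectral constraint (A1) of the cited reduction at `Ra = 1000`, `s = 3`,
`τ′ ≡ −1`, whence `Nu(1000) ≤ 1` from `SpectralReduction` alone. NOT CLAIMED: anything about the Boussinesq reduction itself; no physics.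
-/

set_option linter.style.longLine false

noncomputable section

namespace Summit.NavierStokesRegularity.TurbBounds.TailN0

open Polynomial intervalIntegral MeasureTheory Finset Matrix Set Literature.Analysis.SpecialFunctions
open Summit.NavierStokesRegularity.TurbBounds.LadderTail (w IsLadder phi lam w_pos lam_pos)
open Summit.NavierStokesRegularity.TurbBounds.LegendreCoeffs
open Summit.NavierStokesRegularity.TurbBounds.CouplingSplit (pairWeight couplingExact)
open Summit.NavierStokesRegularity.TurbBounds.TailPolyGenW (rbForm finGenW rbForm_poly_lower_bound)
open Summit.NavierStokesRegularity.TurbBounds.TailTwoSided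
open Summit.NavierStokesRegularity.TurbBounds.Certs.N0.Evaluator (Ra a0 s T ghat0 lamW lamT K_c MelR)

/-! ## 1. The (constant) coupling profile as a degree-0 polynomial in the Legendre basis -/

/-- `gp = Σ_{p ≤ 0} ĝ_p P_p = C ĝ₀`. -/
def gp : ℝ[X] := ∑ p ∈ range (0 + 1), C (ghatR p) * legendre p

/-- `deg gp ≤ 0`. -/
theorem natDegree_gp_le : gp.natDegree ≤ 0 := by
  unfold gp
  refine natDegree_sum_le_of_forall_le _ _ (fun p hp => ?_)
  refine (natDegree_C_mul_le _ _).trans ?_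
  rw [natDegree_legendre]
  rw [Finset.mem_range] at hp; omega

/-- `gp ≡ ĝ₀ = −s = −3`. -/
theorem gp_eval (x : ℝ) : gp.eval x = ((ghat0 : ℚ) : ℝ) := by
  unfold gp
  simp [ghatR, legendre_zero]

/-- The Legendre data of `gp` are the literal `ĝ`. -/
theorem legCoeff_gp (p : ℕ) : legCoeff gp p = if p ≤ 0 then ghatR p else 0 := by
  unfold gp; exact legCoeff_expansion 0 ghatR p

/-- pair weights with `ĉ(gp)` are those with the literal `ĝ` -/
theorem pairWeight_gp (n m : ℕ) : pairWeight 0 (legCoeff gp) n m = pairWeight 0 ghatR n m := by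
  unfold pairWeight
  refine sum_congr rfl fun p hp => ?_
  rw [legCoeff_gp, if_pos (by rw [Finset.mem_range] at hp; omega)]

/-- exact coupling with `ĉ(gp)` is the one with the literal `ĝ` -/
theorem couplingExact_gp (N : ℕ) (b e : ℕ → ℝ) : couplingExact N 0 (legCoeff gp) b e = couplingExact N 0 ghatR b e := by
  unfold couplingExact; simp_rw [pairWeight_gp]

/-- Hence the tracked finite part with `ĉ(gp)` is the one with the literal `ĝ`. -/
theorem finGenW_gp (N : ℕ) (A B u v ε' T' : ℝ) (c a b d e : ℕ → ℝ) :
    finGenW N 0 A B u v ε' T' (legCoeff gp) c a b d e = finGenW N 0 A B u v ε' T' ghatR c a b d e := by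
  unfold finGenW; rw [couplingExact_gp]

/-- `|g| = |ĝ₀| = 3 ≤ T = 3` on `[-1, 1]`. -/
theorem gp_abs_le : ∀ x ∈ Icc (-1 : ℝ) 1, |gp.eval x| ≤ ((T : ℚ) : ℝ) := by
  intro x _
  rw [gp_eval]
  norm_num [ghat0, s, T]

/-! ## 2. Polynomial level: the certificate's element conditions ⇒ the RB-type form is `≥ 0` on two-sided polynomial pairs -/

/-- **Positivity on two-sided polynomial test fields** from the element LMI `MelR ε (1/K) K ⪰ 0` and its two scalar slack lines
(rbsdp SPEC 3.5–3.7, `(N, P) = (8, 0)`, projected class). -/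
theorem rbForm_poly_nonneg {K : ℝ} (hK : 0 < K) {ε : ℝ} (hε : 0 < ε) (hM : (MelR ε (1 / K) K).PosSemidef)
    (hW : 0 ≤ 16 * (1 / K) * (a0 : ℝ) - (T : ℝ) * ε * (lamW : ℝ)) (hT : 0 ≤ 4 * (s : ℝ) - (T : ℝ) * (lamT : ℝ) / ε)
    (Wp Θp : ℝ[X]) (h0 : Wp.eval (-1) = 0) (h1 : (derivative Wp).eval (-1) = 0) (h0' : Wp.eval 1 = 0) (h1' : (derivative Wp).eval 1 = 0)
    (hΘ0 : Θp.eval (-1) = 0) (hΘ0' : Θp.eval 1 = 0) :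
    0 ≤ rbForm ((a0 : ℚ) : ℝ) ((s : ℚ) : ℝ) (fun _ => ((ghat0 : ℚ) : ℝ)) K (fun x => Wp.eval x) (fun x => Θp.eval x) := by
  have hA0 : (0 : ℝ) ≤ ((a0 : ℚ) : ℝ) := by norm_num [a0, s, Ra]
  have hB0 : (0 : ℝ) ≤ ((s : ℚ) : ℝ) := by norm_num [s]
  have hlb := rbForm_poly_lower_bound 8 0 gp natDegree_gp_le (fun x => (gp_eval x).symm) gp_abs_le hA0 hB0 hK hε Wp Θp h0 h1 hΘ0
  rw [finGenW_gp] at hlb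
  obtain ⟨hc0, hc1⟩ := legCoeff_farWall_W Wp h0 h1 h0' h1'
  have hd0 := legCoeff_farWall_Θ Θp hΘ0 hΘ0'
  set V1 := derivative Wp with hV1def
  set V2 := derivative V1 with hV2def
  set Θ1 := derivative Θp with hΘ1def
  set c := legCoeff V2 with hc
  set a := legCoeff V1 with ha
  set b := legCoeff Wp with hb
  set d := legCoeff Θ1 with hd
  set e := legCoeff Θp with he
  have hA : IsLadder c a := by rw [hc, ha, hV2def]; exact isLadder_legCoeff V1 h1
  have hB : IsLadder a b := by rw [ha, hb, hV1def]; exact isLadder_legCoeff Wp h0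
  have hE : IsLadder d e := by rw [hd, he, hΘ1def]; exact isLadder_legCoeff Θp hΘ0
  have ha0 : a 0 = c 0 - c 1 / 3 := by rw [ha, hc, hV2def]; exact legCoeff_zero_of_wall V1 h1
  have hb0 : b 0 = a 0 - a 1 / 3 := by rw [hb, ha, hV1def]; exact legCoeff_zero_of_wall Wp h0
  have he0 : e 0 = d 0 - d 1 / 3 := by rw [he, hd, hΘ1def]; exact legCoeff_zero_of_wall Θp hΘ0
  clear_value c a b d e
  have key := finGenW_eq_quadForm hA hB hE ha0 hb0 he0 hc0 hc1 hd0 ε (1 / K) K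
  have hq : 0 ≤ stack c d ⬝ᵥ (MelR ε (1 / K) K *ᵥ stack c d) := by
    have h := hM.dotProduct_mulVec_nonneg (stack c d)
    rwa [star_trivial] at h
  have hRc0 : 0 ≤ ∑ k ∈ range (max Wp.natDegree Θp.natDegree + 2), w (8 + 0 + 3 + k) * c (8 + 0 + 3 + k) ^ 2 :=
    sum_nonneg fun k _ => mul_nonneg (w_pos _).le (sq_nonneg _)
  have hRd0 : 0 ≤ ∑ k ∈ range (max Wp.natDegree Θp.natDegree + 2), w (8 + 0 + 2 + k) * d (8 + 0 + 2 + k) ^ 2 :=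
    sum_nonneg fun k _ => mul_nonneg (w_pos _).le (sq_nonneg _)
  have hlamW : ((lamW : ℚ) : ℝ) = lam (8 + 0) * lam (8 + 0 + 1) := by norm_num [lamW, lam]
  have hlamT : ((lamT : ℚ) : ℝ) = lam (8 + 0) := by norm_num [lamT, lam]
  have hW' : 0 ≤ (16 * (1 / K) * ((a0 : ℚ) : ℝ) - ((T : ℚ) : ℝ) * ε * (lam (8 + 0) * lam (8 + 0 + 1)))
      * ∑ k ∈ range (max Wp.natDegree Θp.natDegree + 2), w (8 + 0 + 3 + k) * c (8 + 0 + 3 + k) ^ 2 := by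
    rw [← hlamW]; exact mul_nonneg hW hRc0
  have hT' : 0 ≤ (4 * ((s : ℚ) : ℝ) - ((T : ℚ) : ℝ) * lam (8 + 0) / ε)
      * ∑ k ∈ range (max Wp.natDegree Θp.natDegree + 2), w (8 + 0 + 2 + k) * d (8 + 0 + 2 + k) ^ 2 := by
    rw [← hlamT]; exact mul_nonneg hT hRd0
  linarith [hlb, key, hq, hW', hT']

/-! ## 3. Density and cover: the RB-type form of row N0 is `≥ 0` on the two-sided class for EVERY `K > 0` -/

/-- On the certified range `0 < K ≤ K_c = 39`: the form is `≥ 0` on the whole two-sided `C² × C¹` class (certificate + tail lemma + density). -/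
theorem rbForm_nonneg_of_cert {K : ℝ} (hK : 0 < K) (hKc : K ≤ 39) (W Θ : ℝ → ℝ) (hWΘ : TwoSidedX W Θ) :
    0 ≤ rbForm ((a0 : ℚ) : ℝ) ((s : ℚ) : ℝ) (fun _ => ((ghat0 : ℚ) : ℝ)) K W Θ := by
  have hKc' : K ≤ ((K_c : ℚ) : ℝ) := by norm_num [K_c]; exact hKc
  obtain ⟨ε, hε, hM, hW, hT⟩ := Certs.N0.Evaluator.certificate K hK hKc'
  exact RBDensity.rbForm_nonneg_of_poly2 continuous_const
    (fun Wp Θp h0 h1 h0' h1' hΘ0 hΘ0' => rbForm_poly_nonneg hK hε hM hW hT Wp Θp h0 h1 h0' h1' hΘ0 hΘ0') hWΘ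

/-- **RB-N0: the mode form is `≥ 0` on the two-sided class for every wavenumber datum `K = k² > 0`** (certified range + cutoff `K ≥ 39`,
the tree's `Certs.N0.Evaluator.cutoff : T² ≤ a0·s·K_c²`). -/
theorem rbPositivity_holds : RBPositivity ((a0 : ℚ) : ℝ) ((s : ℚ) : ℝ) (fun _ => ((ghat0 : ℚ) : ℝ)) := by
  have hA0 : (0 : ℝ) ≤ ((a0 : ℚ) : ℝ) := by norm_num [a0, s, Ra]
  have hB0 : (0 : ℝ) ≤ ((s : ℚ) : ℝ) := by norm_num [s]
  have hg : ∀ x ∈ Icc (-1 : ℝ) 1, |(fun _ : ℝ => ((ghat0 : ℚ) : ℝ)) x| ≤ ((T : ℚ) : ℝ) := by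
    intro x _; norm_num [ghat0, s, T]
  have hcut : ((T : ℚ) : ℝ) ^ 2 ≤ ((a0 : ℚ) : ℝ) * ((s : ℚ) : ℝ) * (39 : ℝ) ^ 2 := by
    have h : ((T : ℚ) : ℝ) ^ 2 ≤ ((a0 : ℚ) : ℝ) * ((s : ℚ) : ℝ) * ((K_c : ℚ) : ℝ) ^ 2 := by
      exact_mod_cast Certs.N0.Evaluator.cutoff
    have e : ((K_c : ℚ) : ℝ) = (39 : ℝ) := by norm_num [K_c]
    rwa [e] at h
  exact rbPositivity_of_cover hA0 hB0 (by norm_num) hg hcut (fun K hK hKc W Θ hWΘ => rbForm_nonneg_of_cert hK hKc W Θ hWΘ)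

end Summit.NavierStokesRegularity.TurbBounds.TailN0

end
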